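import Summits.NavierStokesRegularity.NavierStokesRegularity.Theorems.ForcedAmplifierBridge
import Literature.Analysis.FunctionSpaces.TorusClassicalNSHorizonPatching

/-!
# `ForcedAmplifier.Exactness` HOLDS (route `ForcedAmplifier`, aside, decomp-ns node N31, negative board)

Route `Summits/NavierStokesRegularity/NavierStokesRegularity/Theses/ForcedAmplifier.lean`
(`closes_target` = the erratum leaf D♯ `NavierStokesBreakdownPeriodicPressurePeriodic`).  The aside
`Exactness` (stmt-NavierStokesRegularity-28105) is the CONVERSE board translation certifying that the
decomposition loses nothing: a D♯ datum at viscosity `ν` refutes Tao's 2013 Conjecture 1.8 (torus form,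
periodic pressure, forces jointly smooth on `[0,∞) × 𝕋³`) at the same viscosity.  Together with the
in-cone support `Bridge` (`Theorems/ForcedAmplifierBridge.lean`) it gives, unconditionally,
D♯ ⟺ «Conjecture 1.8 fails at every viscosity» (`target_iff_not_smoothForcedRegular`); in particular
D♯ ⟹ `QuantitativeGap` vacuously (the door is a CONSEQUENCE of the target — the Lean half of its WEAKER
tag; deliberately NOT stated as a theorem with head `QuantitativeGap` here, so that no file audit reads a
conditional implication as a proof of the open crux stmt-NavierStokesRegularity-28102).

Proof (port of the lens-4 g25 proof `ForcedAmplifierBridge.exactness_holds`, sha256 `c174d19f…`, critic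
CLEARED (KERNEL) rows 251/252, onto the def-free route declaration): descend `(U₀, F)` to the torus
(`u₀ := U₀ ∘ repr`, `f(t) := F(t) ∘ repr`, so `lift u₀ = U₀`, `lift (f t) = F t` for `t ≥ 0` by
`Torus.lift_descend_holds`; `f` is jointly smooth on `[0,∞) × 𝕋³` because its space–time lift agrees
with `uncurry F` on the half-space); if every slab `[0,T]` carried a classical solution from `u₀`,
forward uniqueness patches them to `[0,∞)` (`Torus.IsClassicalNSSolutionOn.exists_Ici_iff_forall_Icc`,
tree file `TorusClassicalNSHorizonPatching`), and the lift (`IsClassicalNSSolutionOn.of_torus_holds`)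
with the original force put back (`ForcedAmplifierBridge.classicalNS_congr`) is a smooth solution on
`ℝ³ × [0,∞)` from `U₀` with periodic velocity and pressure — contradicting D♯.
[cite: RobinsonRodrigoSadowskiCUP2016, §8.1; Tao2013Localisation, Thm 5.1 (uniqueness) and Conj. 1.8;
FeffermanClay2006, (D) + errata]
-/

set_option linter.dupNamespace false

noncomputable section

open Set Function Filter
open scoped ContDiff Topology
open Literature.Analysis.FunctionSpaces Literature.Analysis.FluidPDE

namespace Summit.NavierStokesRegularity.NavierStokesRegularity.Theorems.ForcedAmplifierExactness

/-- Local notation: the flat unit 3-torus. -/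
local notation "T3" => UnitAddTorus (Fin 3)
/-- Local notation: Euclidean 3-space. -/
local notation "R3" => EuclideanSpace ℝ (Fin 3)

/-- **`Exactness` HOLDS** (aside stmt-NavierStokesRegularity-28105 of route `ForcedAmplifier`): a D♯
datum at viscosity `ν` refutes Tao's Conjecture 1.8 at `ν`.
[cite: RobinsonRodrigoSadowskiCUP2016, §8.1; Tao2013Localisation, Thm 5.1; FeffermanClay2006, (D) + errata] -/
theorem exactness_holds : Theses.ForcedAmplifier.Exactness := by
  intro ν hν hB hS
  obtain ⟨U₀, F, hU₀, hdiv, hperU₀, hF, hperF, -, hno⟩ := hB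
  -- the descended datum and force
  set u₀ : T3 → R3 := fun z => U₀ (Torus.repr z) with hu₀def
  set fT : ℝ → T3 → R3 := fun t z => F t (Torus.repr z) with hfTdef
  have hlift₀ : Torus.lift u₀ = U₀ := Torus.lift_descend_holds U₀ hperU₀
  have hliftF : ∀ t : ℝ, 0 ≤ t → Torus.lift (fT t) = F t := fun t ht =>
    Torus.lift_descend_holds (F t) (hperF t ht)
  have hsm₀ : Torus.IsSmooth u₀ := by
    show ContDiff ℝ ∞ (Torus.lift u₀)
    rw [hlift₀]
    exact hU₀
  have hdiv₀ : Torus.IsDivFree u₀ := by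
    refine (isDivFree_lift_iff (hsm₀.isContDiff (by simp))).1 ?_
    rw [hlift₀]
    exact hdiv
  have hfT : Torus.IsSmoothSpaceTimeOn (Ici 0) fT := by
    unfold Torus.IsSmoothSpaceTimeOn
    refine hF.congr ?_
    intro z hz
    exact congrFun (hliftF z.1 (mem_prod.1 hz).1) z.2
  -- classical solutions on every slab `[0, T]`, patched to `[0, ∞)` by forward uniqueness
  have hall : ∀ T : ℝ, 0 < T → ∃ (u : ℝ → T3 → R3) (p : ℝ → T3 → ℝ),
      Torus.IsClassicalNSSolutionOn (Icc 0 T) ν fT u p ∧ u 0 = u₀ :=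
    fun T hT => hS T hT u₀ hsm₀ hdiv₀ fT hfT
  obtain ⟨u, p, hcl, h0⟩ :=
    (Torus.IsClassicalNSSolutionOn.exists_Ici_iff_forall_Icc (f := fT) (u₀ := u₀) hν.le).2 hall
  -- lift to `ℝ³ × [0, ∞)` and put the original force back
  have hR : IsClassicalNSSolutionOn (Ici 0) ν (fun t => Torus.lift (fT t))
      (fun t => Torus.lift (u t)) (fun t => Torus.lift (p t)) :=
    IsClassicalNSSolutionOn.of_torus_holds hcl
  have hR' : IsClassicalNSSolutionOn (Ici 0) ν F (fun t => Torus.lift (u t))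
      (fun t => Torus.lift (p t)) :=
    ForcedAmplifierBridge.classicalNS_congr hR (fun t ht => (hliftF t (mem_Ici.1 ht)).symm)
      (fun _ _ => rfl) (fun _ _ => rfl)
  have h0' : (fun t => Torus.lift (u t)) 0 = U₀ := by
    show Torus.lift (u 0) = U₀
    rw [h0, hlift₀]
  obtain ⟨hns, hUs, hPs⟩ := isNavierStokesSolution_and_smooth_iff.2 ⟨hR', h0'⟩
  exact hno ⟨fun t => Torus.lift (u t), fun t => Torus.lift (p t), hUs, hPs, hns,
    fun t _ => ⟨Torus.isLatticePeriodic_lift (u t), Torus.isLatticePeriodic_lift (p t)⟩⟩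

/-! ## Consequences: the board translation is exact -/

/-- **Board translation, unconditional**: the erratum leaf D♯ says exactly that Tao's Conjecture 1.8
(torus form, periodic pressure, forces smooth on `[0,∞) × 𝕋³`) fails at every viscosity — `Exactness`
one way, the in-cone support `Bridge` (`ForcedAmplifierBridge.bridge_holds`) the other. -/
theorem target_iff_not_smoothForcedRegular :
    NavierStokesBreakdownPeriodicPressurePeriodic ↔
      ∀ ν : ℝ, 0 < ν → ¬ (∀ T : ℝ, 0 < T → ∀ u₀ : T3 → R3, Torus.IsSmooth u₀ → Torus.IsDivFree u₀ →
        ∀ f : ℝ → T3 → R3, Torus.IsSmoothSpaceTimeOn (Ici 0) f →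
          ∃ (u : ℝ → T3 → R3) (p : ℝ → T3 → ℝ), Torus.IsClassicalNSSolutionOn (Icc 0 T) ν f u p ∧
            u 0 = u₀) :=
  ⟨fun h ν hν => exactness_holds ν hν (h ν hν),
    fun h ν hν => ForcedAmplifierBridge.bridge_holds ν hν (h ν hν)⟩

end Summit.NavierStokesRegularity.NavierStokesRegularity.Theorems.ForcedAmplifierExactness

end
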